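import Summits.Ventures.PercRepro2.UnionRowKGen
/-!
# The union row as three covariances: `V = Z·Cov_U(A,B) + M(D)·Cov_Γ(A,B) − Z·Cov_D(A,B)`
(blind cell PercRepro2, mine-1 g42; read off the certificate of the instance `A = {σ_w = S}`, `B = {σ_v = S}`,
`X = {u}`, `Y = {v,w}` in the cone enlarged by positive association GIVEN THE UNION EVENT, then proved as an identity)

Setting of `UnionRowPeel`: cells `ι`, masses `m`, a cut set `D`, cell sets `A`, `B`, the row
`rowV m D A B = Σ_{c ∉ D} m c (Z·1_A(c) − M(A)) (Z·1_B(c) − M(B))`.  For a cell set `E` write the (unnormalised) covariance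
of `A` and `B` inside `E`: `covIn m E A B = M(E)·M(A ∩ B ∩ E) − M(A ∩ E)·M(B ∩ E)`.  Then, EXACTLY, for every `D`, `A`, `B`:

    `rowV m D A B = Z·covIn m Dᶜ A B + M(D)·covIn m univ A B − Z·covIn m D A B`      (`rowV_eq_covSplit`).

So the union row says precisely that the positive association of `A` and `B` INSIDE THE CUT (the double-hit configurations)
is dominated by their association inside the union event `U = Dᶜ` plus a `M(D)/Z` share of their global association.
Consequences (all `k`):
* `rowV_nonneg_of_covIn`: `Cov_U ≥ 0` (positive association given the union event — row 2′CON-U's own (UNION-PA)),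
  `Cov_Γ ≥ 0` (positive association on `Q`) and `Cov_D ≤ 0` give `V ≥ 0`;
* `covIn_nonpos_of_disjoint_inter` / `covIn_nonpos_of_disjoint_compl`: `Cov_D ≤ 0` whenever the cut carries no cell of
  `A ∩ B` (OUT-kind instances) or no cell of `Aᶜ ∩ Bᶜ` (IN-kind instances; `covIn_compl`: the covariance is invariant
  under complementing both sets);
* hence `rowV_nonneg_one_kind`: EVERY one-kind instance of the union row, for any number of observed vertices, follows from
  the two facts (UNION-PA)(A, B) and PA_Q(A, B) — at k = 3 this covers the 3,801 distinct one-kind terminal instances, 3,477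
  of which have no certificate from avoidance-PA alone (mine-1 g42 census), and in particular the two out-kind obstructions
  `A = {σ_w = S}` / `{σ_u ≠ T, σ_w = S}`, `B = {σ_v = S}`, `X = {u}`, `Y = {v, w}`.
-/

namespace Summit.Ventures.PercRepro2.UnionRowCovSplit

open Finset
open Summit.Ventures.PercRepro2.UnionRowPeel
open Summit.Ventures.PercRepro2.UnionRowKGen

variable {ι : Type*} [Fintype ι] [DecidableEq ι]

/-- The unnormalised covariance of `A` and `B` inside the cell set `E`:
`M(E)·M(A ∩ B ∩ E) − M(A ∩ E)·M(B ∩ E)`. -/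
noncomputable def covIn (m : ι → ℝ) (E A B : Finset ι) : ℝ :=
  mass m E * mass m (A ∩ B ∩ E) - mass m (A ∩ E) * mass m (B ∩ E)

omit [Fintype ι] in
/-- `M(A ∩ E) = M(E) − M(E ∖ A)`-type bookkeeping: `M(S ∩ E) + M(E ∖ S) = M(E)`. -/
theorem mass_inter_add_sdiff (m : ι → ℝ) (S E : Finset ι) : mass m (S ∩ E) + mass m (E \ S) = mass m E := by
  have h := mass_sdiff_add m (inter_subset_right (s₁ := S) (s₂ := E))
  have heq : E \ (S ∩ E) = E \ S := by ext c; simp only [mem_sdiff, mem_inter]; tauto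
  rw [heq] at h; linarith

/-- The covariance inside `E` is invariant under complementing both sets. -/
theorem covIn_compl (m : ι → ℝ) (E A B : Finset ι) :
    covIn m E (univ \ A) (univ \ B) = covIn m E A B := by
  unfold covIn
  have hA : mass m ((univ \ A) ∩ E) = mass m E - mass m (A ∩ E) := by
    have h := mass_inter_add_sdiff m A E
    have heq : (univ \ A) ∩ E = E \ A := by ext c; simp only [mem_inter, mem_sdiff, mem_univ, true_and]; tauto
    rw [heq]; linarith
  have hB : mass m ((univ \ B) ∩ E) = mass m E - mass m (B ∩ E) := by
    have h := mass_inter_add_sdiff m B E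
    have heq : (univ \ B) ∩ E = E \ B := by ext c; simp only [mem_inter, mem_sdiff, mem_univ, true_and]; tauto
    rw [heq]; linarith
  have hAB : mass m ((univ \ A) ∩ (univ \ B) ∩ E)
      = mass m E - mass m (A ∩ E) - mass m (B ∩ E) + mass m (A ∩ B ∩ E) := by
    -- inclusion–exclusion inside E: M(E) = M(A∩E) + M(B∩E) − M(A∩B∩E) + M(Aᶜ∩Bᶜ∩E)
    have h1 : mass m ((A ∩ E) ∪ (B ∩ E)) + mass m ((A ∩ E) ∩ (B ∩ E)) = mass m (A ∩ E) + mass m (B ∩ E) := by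
      unfold mass; exact sum_union_inter
    have h2 := mass_inter_add_sdiff m (A ∪ B) E
    have e1 : (A ∩ E) ∪ (B ∩ E) = (A ∪ B) ∩ E := by ext c; simp only [mem_union, mem_inter]; tauto
    have e2 : (A ∩ E) ∩ (B ∩ E) = A ∩ B ∩ E := by ext c; simp only [mem_inter]; tauto
    have e3 : E \ (A ∪ B) = (univ \ A) ∩ (univ \ B) ∩ E := by
      ext c; simp only [mem_sdiff, mem_union, mem_inter, mem_univ, true_and]; tauto
    rw [e1, e2] at h1; rw [e3] at h2; linarith
  rw [hA, hB, hAB]; ring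

/-- THE SPLIT: `V = Z·Cov_{Dᶜ}(A,B) + M(D)·Cov_Γ(A,B) − Z·Cov_D(A,B)`, exactly, for every `D`, `A`, `B`. -/
theorem rowV_eq_covSplit (m : ι → ℝ) (D A B : Finset ι) :
    rowV m D A B
      = mass m univ * covIn m (univ \ D) A B + mass m D * covIn m univ A B
        - mass m univ * covIn m D A B := by
  rw [rowV_expand]; unfold covIn
  have e1 : A ∩ (univ \ D) = A \ D := by ext c; simp only [mem_inter, mem_sdiff, mem_univ, true_and]
  have e2 : B ∩ (univ \ D) = B \ D := by ext c; simp only [mem_inter, mem_sdiff, mem_univ, true_and]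
  have e3 : A ∩ B ∩ (univ \ D) = (A ∩ B) \ D := by ext c; simp only [mem_inter, mem_sdiff, mem_univ, true_and]
  have e4 : A ∩ univ = A := inter_univ A
  have e5 : B ∩ univ = B := inter_univ B
  have e6 : A ∩ B ∩ univ = A ∩ B := inter_univ (A ∩ B)
  rw [e1, e2, e3, e4, e5, e6]
  have hA : mass m (A \ D) = mass m A - mass m (A ∩ D) := by
    have := mass_inter_add_sdiff m D A; rw [inter_comm] at this; linarith
  have hB : mass m (B \ D) = mass m B - mass m (B ∩ D) := by
    have := mass_inter_add_sdiff m D B; rw [inter_comm] at this; linarith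
  have hAB : mass m ((A ∩ B) \ D) = mass m (A ∩ B) - mass m (A ∩ B ∩ D) := by
    have := mass_inter_add_sdiff m D (A ∩ B); rw [inter_comm] at this; linarith
  have hU : mass m (univ \ D) = mass m univ - mass m D := by
    have := mass_sdiff_add m (subset_univ D); linarith
  rw [hA, hB, hAB, hU]; ring

/-- `Cov_U ≥ 0`, `Cov_Γ ≥ 0` and `Cov_D ≤ 0` give `V ≥ 0` (nonnegative masses). -/
theorem rowV_nonneg_of_covIn {m : ι → ℝ} (hm : ∀ x, 0 ≤ m x) (D A B : Finset ι)
    (hU : 0 ≤ covIn m (univ \ D) A B) (hQ : 0 ≤ covIn m univ A B) (hD : covIn m D A B ≤ 0) :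
    0 ≤ rowV m D A B := by
  rw [rowV_eq_covSplit]
  have hZ := mass_nonneg hm univ
  have hDm := mass_nonneg hm D
  nlinarith [mul_nonneg hZ hU, mul_nonneg hDm hQ, mul_nonneg hZ (neg_nonneg.2 hD)]

omit [Fintype ι] in
/-- If the cut carries no cell of `A ∩ B`, then `Cov_D(A,B) = −M(A∩D)·M(B∩D) ≤ 0`. -/
theorem covIn_nonpos_of_disjoint_inter {m : ι → ℝ} (hm : ∀ x, 0 ≤ m x) (D A B : Finset ι)
    (h : Disjoint (A ∩ B) D) : covIn m D A B ≤ 0 := by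
  unfold covIn
  have h0 : A ∩ B ∩ D = ∅ := by
    rw [← disjoint_iff_inter_eq_empty]; exact h
  rw [h0]
  have : mass m (∅ : Finset ι) = 0 := by unfold mass; simp
  rw [this]
  have := mul_nonneg (mass_nonneg hm (A ∩ D)) (mass_nonneg hm (B ∩ D))
  linarith

/-- If the cut carries no cell of `Aᶜ ∩ Bᶜ`, then `Cov_D(A,B) ≤ 0` (by complement invariance). -/
theorem covIn_nonpos_of_disjoint_compl {m : ι → ℝ} (hm : ∀ x, 0 ≤ m x) (D A B : Finset ι)
    (h : Disjoint ((univ \ A) ∩ (univ \ B)) D) : covIn m D A B ≤ 0 := by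
  rw [← covIn_compl]
  exact covIn_nonpos_of_disjoint_inter hm D _ _ h

/-- EVERY ONE-KIND INSTANCE from two facts: if the cut carries no cell of `A ∩ B` or no cell of `Aᶜ ∩ Bᶜ`, then
positive association of `A`, `B` given the union event (`Cov_{Dᶜ} ≥ 0`) and on the whole grid (`Cov_Γ ≥ 0`) give `V ≥ 0`. -/
theorem rowV_nonneg_one_kind {m : ι → ℝ} (hm : ∀ x, 0 ≤ m x) (D A B : Finset ι)
    (hkind : Disjoint (A ∩ B) D ∨ Disjoint ((univ \ A) ∩ (univ \ B)) D)
    (hU : 0 ≤ covIn m (univ \ D) A B) (hQ : 0 ≤ covIn m univ A B) :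
    0 ≤ rowV m D A B := by
  apply rowV_nonneg_of_covIn hm D A B hU hQ
  rcases hkind with h | h
  · exact covIn_nonpos_of_disjoint_inter hm D A B h
  · exact covIn_nonpos_of_disjoint_compl hm D A B h

end Summit.Ventures.PercRepro2.UnionRowCovSplit
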